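import Summits.CriticalPhenomena.PercolationContinuityZ3.Theorems.PercAnnulusCrossingIICTargetLevelTwoSided
import Summits.CriticalPhenomena.PercolationContinuityZ3.Theorems.PercAnnulusCrossingIICTop
import HarnessLib

/-!
# Kesten–Basu–Sapozhnikov IIC scheme in boxes with a GENERAL CONDITIONING TARGET, XIX″: the top level (lane RSW3, p1 gen 4)

builds on p205010 (kernel theorem, internal audit signed; external expert review pending)

Seat `prim-rsw3-p1` (gen 4).  Part XIX′ (`PercAnnulusCrossingIICAspectTop.lean`) with the conditioning event `{0 ↔ ∂ⁱⁿΛ(N)}` replaced by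
`COND(W,T) = CONN(∅,{0};W,T) = {0 ↔ T in W}` for finite `W ⊇ Λ(τ M₂)`, `T ⊆ W ∖ Λ(τ M₂)` (Basu–Sapozhnikov Remark 2.1).  Helper file;
no definitions, no sorries.
* **`top_two_sided_target`** — `S_E(W,T) ≤ P(E ∩ COND(W,T)) ≤ S_E(W,T) + ϰ⁻² α(σ M₁, σ M₂) P(COND(W,T))`.
References: H. Kesten, PTRF 73 (1986) §2 eq. (22); D. Basu, A. Sapozhnikov, ECP 22 (2017) no. 26, §2 (2.5) and Remark 2.1.
-/

noncomputable section

namespace Summit.CriticalPhenomena.PercolationContinuityZ3.Theorems.Crossing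

open MeasureTheory Literature.Probability.Percolation Literature.Probability.LatticeModels
open Literature.Probability.Percolation.DCT16
open Summit.CriticalPhenomena.PercolationContinuityZ3.Theorems.SurfaceTension
open scoped Literature.Probability.Percolation

variable {d : ℕ}

/-- **The top level, two-sided, general aspect and general conditioning target**: for `E` determined by `F' ⊆ Λ(σ M₁).sym2`,
`1 ≤ M₁ ≤ M₂`, `τ M₁ < σ M₂`, `Λ(τ M₂) ⊆ W`, `T ⊆ W ∖ Λ(τ M₂)`:  `S_E ≤ P(E ∩ {0 ↔ T in W}) ≤ S_E + ϰ⁻² α(σ M₁, σ M₂) P(0 ↔ T in W)`. [cite: Kesten1986, §2 eq. (22)] [cite: BasuSapozhnikov2017ECP, §2 (2.5)] -/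
theorem top_two_sided_target (p : unitInterval) {ϰ : ℝ} (hϰ : 0 < ϰ)
    {σ τ : ℕ → ℕ} (hσ : ∀ m : ℕ, 1 ≤ m → m < σ m) (hστ : ∀ m : ℕ, 1 ≤ m → σ m < τ m)
    (hA2 : ∀ m : ℕ, 1 ≤ m → ∀ Z : Finset (Site d), box d (τ m) \ box d (m - 1) ⊆ Z →
      ∀ X : Finset (Site d), X ⊆ Z ∩ box d m → ∀ Y : Finset (Site d), Y ⊆ Z \ box d (τ m) →
        ϰ * (bondPercolation (zdGraph d) p).real {ω | ∃ x ∈ X, ∃ s ∈ innerBoundary (zdGraph d) (box d (σ m)),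
              ω ∈ openConnIn (↑Z : Set (Site d)) x s} *
          (bondPercolation (zdGraph d) p).real {ω | ∃ y ∈ Y, ∃ s ∈ innerBoundary (zdGraph d) (box d (σ m)),
              ω ∈ openConnIn (↑Z : Set (Site d)) y s} ≤
        (bondPercolation (zdGraph d) p).real {ω | ∃ x ∈ X, ∃ y ∈ Y, ω ∈ openConnIn (↑Z : Set (Site d)) x y})
    {M₁ M₂ : ℕ} (hM₁ : 1 ≤ M₁) (hM₁₂ : M₁ ≤ M₂) (h12 : τ M₁ < σ M₂) {W T : Finset (Site d)} (hW : box d (τ M₂) ⊆ W)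
    (hTW : T ⊆ W) (hTb : ∀ t ∈ T, t ∉ box d (τ M₂))
    {E : Set (BondConfig (Site d))} {F' : Finset (Sym2 (Site d))} (hE : DeterminedBy E ↑F') (hF' : F' ⊆ (box d (σ M₁)).sym2) :
    ∑ C ∈ ((box d (σ M₂)).powerset.filter (fun U => box d (σ M₁) ⊆ U)) ×ˢ (box d (σ M₂ + 1)).powerset,
        (bondPercolation (zdGraph d) p).real (E ∩
          {ω : BondConfig (Site d) | ω ∩ (↑((box d (σ M₂ + 1)).sym2) : Set (Sym2 (Site d))) ∈
            explEvent (↑(box d (σ M₁)) : Set (Site d)) ((↑(box d (σ M₂)) : Set (Site d)) \ ↑(box d (σ M₁))) ↑C.1 ↑C.2} ∩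
          {ω : BondConfig (Site d) | ∀ r ∈ C.2, ∀ r' ∈ C.2, ∃ v ∈ C.1, ∃ v' ∈ C.1,
            s(v, r) ∈ ω ∧ s(v', r') ∈ ω ∧ ω ∈ openConnIn ((↑C.1 : Set (Site d)) \ ↑(box d (σ M₁ - 1))) v v'} ∩
          {ω : BondConfig (Site d) | ∃ x ∈ ({0} : Finset (Site d)), ∃ r ∈ C.2, ∃ v ∈ C.1, ω ∈ openConnIn ((↑C.1 : Set (Site d)) \ ↑(∅ : Finset (Site d))) x v ∧ s(v, r) ∈ ω}) *
        (bondPercolation (zdGraph d) p).real {ω : BondConfig (Site d) | ∃ x ∈ C.2, ∃ t ∈ T,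
            ω ∈ openConnIn ((↑W : Set (Site d)) \ ↑C.1) x t} ≤
      (bondPercolation (zdGraph d) p).real (E ∩ {ω : BondConfig (Site d) | ∃ x ∈ ({0} : Finset (Site d)), ∃ t ∈ T,
          ω ∈ openConnIn ((↑W : Set (Site d)) \ ↑(∅ : Finset (Site d))) x t}) ∧
    (bondPercolation (zdGraph d) p).real (E ∩ {ω : BondConfig (Site d) | ∃ x ∈ ({0} : Finset (Site d)), ∃ t ∈ T,
          ω ∈ openConnIn ((↑W : Set (Site d)) \ ↑(∅ : Finset (Site d))) x t}) ≤
      ∑ C ∈ ((box d (σ M₂)).powerset.filter (fun U => box d (σ M₁) ⊆ U)) ×ˢ (box d (σ M₂ + 1)).powerset,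
        (bondPercolation (zdGraph d) p).real (E ∩
          {ω : BondConfig (Site d) | ω ∩ (↑((box d (σ M₂ + 1)).sym2) : Set (Sym2 (Site d))) ∈
            explEvent (↑(box d (σ M₁)) : Set (Site d)) ((↑(box d (σ M₂)) : Set (Site d)) \ ↑(box d (σ M₁))) ↑C.1 ↑C.2} ∩
          {ω : BondConfig (Site d) | ∀ r ∈ C.2, ∀ r' ∈ C.2, ∃ v ∈ C.1, ∃ v' ∈ C.1,
            s(v, r) ∈ ω ∧ s(v', r') ∈ ω ∧ ω ∈ openConnIn ((↑C.1 : Set (Site d)) \ ↑(box d (σ M₁ - 1))) v v'} ∩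
          {ω : BondConfig (Site d) | ∃ x ∈ ({0} : Finset (Site d)), ∃ r ∈ C.2, ∃ v ∈ C.1, ω ∈ openConnIn ((↑C.1 : Set (Site d)) \ ↑(∅ : Finset (Site d))) x v ∧ s(v, r) ∈ ω}) *
        (bondPercolation (zdGraph d) p).real {ω : BondConfig (Site d) | ∃ x ∈ C.2, ∃ t ∈ T,
            ω ∈ openConnIn ((↑W : Set (Site d)) \ ↑C.1) x t} +
      ϰ⁻¹ ^ 2 * (bondPercolation (zdGraph d) p).real (boxCrossing d (σ M₁) (σ M₂)) *
        (bondPercolation (zdGraph d) p).real {ω : BondConfig (Site d) | ∃ x ∈ ({0} : Finset (Site d)), ∃ t ∈ T,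
          ω ∈ openConnIn ((↑W : Set (Site d)) \ ↑(∅ : Finset (Site d))) x t} := by
  classical
  have hX : ({0} : Finset (Site d)) ⊆ box d M₁ := Finset.singleton_subset_iff.2 (zero_mem_box d M₁)
  have h := sum_real_level_two_sided_target p hϰ hσ hστ hA2 hM₁ hM₁₂ h12 hW hTW hTb (H := (∅ : Finset (Site d)))
    (X := ({0} : Finset (Site d)))
    (Finset.empty_subset _) hX (fun x _ => Finset.notMem_empty x) hE hF'
  refine ⟨h.2, ?_⟩
  linarith [h.1]

end Summit.CriticalPhenomena.PercolationContinuityZ3.Theorems.Crossing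

end
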